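import Summits.QuantumFields.BalabanUV.Beta.D1BFx.ReducedKernelF
import Summits.QuantumFields.BalabanUV.Beta.D1BFx.GhostStencil

/-!
# `BalabanUV.Beta.D1BFx.GhostKernel` — road «BF-x» for binder row D1, sub-leaf T7-gh: THE GHOST FINE ONE-SHOT KERNEL
# `Pgh n a cK cQ cW := TOfGh n a (Sgh n cK cQ) (tableRedDiag n (cW • ghCnt))` — the typer's ghost leg (T2) and ghost stencils (T6) plugged
# into the dressed reduced kernel (T8-gh) — IS A WELL-TYPED (1.22)-KERNEL FOR EVERY BLOCK SIZE, UNCONDITIONALLY: every channel has a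
# (5.10)-shape exponential majorant and absolutely summable second moments; plus the two generic pieces this needs: the TWO-CENTRE
# superposition lemma and the `ℋ⊗ℋ`-dressing of a bond-diagonal second-order table

HONEST FRAMING (cell contract, verbatim): «discharging `BetaPertH` makes Bałaban's UV stability UNCONDITIONAL — a real constructive-QFT
result; it is NOT the continuum limit and NOT the Clay problem.»  HONEST DEPENDENCY (verbatim): «continuum YM on T⁴ ⇐ BetaPertH ∧ nine
spine estimates (0/9 proved); BetaPertH ⇐ (D1) ∧ (D4) ∧ CAP+tail; G-an2-4 gates asym, D1 and NE2/3/4.»  THIS MODULE DISCHARGES NOTHING of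
the wall.  Two definitions with bodies (`tableRedDiag`, `Pgh`) and [folklore] kernel bookkeeping composed BY NAME from the tree
(`OneStepResolventKernel.wsum`/`wsum_shift`/`biLoc_finset_sum`, `ExpKernelCalculus.summable_exp_shift`/`tsum_exp_shift`/`l1_sub_triangle`/
`absMoment₂_hessKer`/`hdec_hessKer`/`hess_eq_hessKer`, `KernelSpecInstance.decay_wH`, the typer's
`GhostLeg.decays_Ggh`/`shiftK_Ggh_neg` and `GhostStencil.biLoc_Sgh`/`Sgh_translate`/`biLoc_ghCnt`/`ghCnt_translate`, my `ReducedKernelF`).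
No `Prop` is minted; nothing printed is asserted; 0 sorry.  SCOPE = T6 v1 (the second jets of `Q′(U)` are not in `Wgh`; the loop weight of
leaf R1 is NOT applied — the caller multiplies by its scalar).  NOT summit progress; NOT BetaPertH, NOT continuum, NOT Clay.

ABSOLUTE RULE (cell, verbatim): «No internally-minted statement may enter as a cited fact. Every hypothesis is either kernel-proved in this
package or a verbatim quotation of a PUBLISHED theorem with page reference. The manuscript(s) under audit are NOT citable for their own
disputed steps — they are the thing under adjudication; programme-internal (2001/route/tribunal) claims are never citable.»

WHY (skeleton `HOME/beta/skeletons/D1-b2b-balaban-beta-d1-p2.md` v1.4 node O, TYPER-SPEC §1 T7 «`Pgh` likewise with loop weight `(+1)` …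
`AbsMoment₂`-type summability from `abs_bubble_le`/`abs_tadpole_le`»; claim table `LEAVES-BFx.md` row T7, SUB-LEAF T7-gh).  With T2 (`Ggh`),
T6 (`Sgh`, `Wgh = [same bond]·cW·ghCnt`) and T8-gh (`TOfGh`) in the tree, the ghost fine kernel is a composition; the one missing generic
fact is that the `ℋ⊗ℋ`-dressing of a BOND-DIAGONAL fine table is a `VertexFamily₂` at the coarse bonds — for a diagonal table the double
superposition collapses to ONE superposition with the two-centre weight `ℋ_{(κ′,u),(μ,y)}·ℋ_{(κ′,u),(ν,y′)}`, handled by `biLoc_wsum_pair`.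

CONTENT (all [folklore] / [our object]).
* §1 `biLoc_wsum_pair` (generic `D`, `F`): weights `|w u| ≤ Cw·e^{−δ(|u−p|₁+|u−q|₁)}`, stencils `BiLoc (K u) u u Ck δ`, `δ > 0` ⟹
  `BiLoc (wsum w K) p q (Cw·Ck·Zl D (δ/2)) (δ/2)`.
* §2 `tableRedDiag n T` (generic fibre), `vertexFamily₂_tableRedDiag` (explicit), `tableRedDiag_translate` (block covariance);
  `vertexRedF_translate_block` (the block-vector twin of `ReducedKernelF.vertexRedF_translate`, which T6's block-structured `Sgh` needs).
* §3 `Pgh`, `blockCovariant_Pgh` / `hess_eq_Pgh` (base point), `exists_vertexFamily_Sgh`, `exists_vertexFamily₂_ghTable`, **`absMoment₂_Pgh`**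
  and **`exists_decay510_Pgh`** (`0 < a`; NO other hypothesis) — per `n` (ghost rate `∝ 1/n`; no uniformity claimed).
-/

noncomputable section

namespace Summit.QuantumFields.BalabanUV.Beta.D1BFx.GhostKernel

open Finset
open Literature.MathematicalPhysics.QuantumFieldTheory.Balaban1983to89
open Literature.MathematicalPhysics.QuantumFieldTheory.Balaban1983to89.Beta
open B12Sec2to5 (l1 l1_nonneg Decay510)
open B6QGQDecay237 (deltaU deltaU_pos)
open ExpKernelCalculus (Site MKer Decays BiLoc VertexFamily VertexFamily₂ shiftK BlockCovariant hess hessKer hess_eq_hessKer Zl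
  absMoment₂_hessKer hdec_hessKer summable_exp_shift tsum_exp_shift l1_sub_triangle)
open DecimatedMomentSummable (AbsMoment₂)
open KernelSpecInstance (wH decay_wH)
open OneStepResolventKernel (wsum wsum_shift biLoc_finset_sum bound_mono decays_mono biLoc_mono)
open Summit.QuantumFields.BalabanUV.Beta.D1BFx.GhostLeg (Ggh decays_Ggh shiftK_Ggh_neg const_nonneg)
open Summit.QuantumFields.BalabanUV.Beta.D1BFx.GhostStencil (Sgh ghCnt biLoc_Sgh Sgh_translate biLoc_ghCnt ghCnt_translate)
open Summit.QuantumFields.BalabanUV.Beta.D1BFx.ReducedKernelF (vertexRedF TOfLeg TOfGh vertexFamily_vertexRedF absMoment₂_TOfGh)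

/-! ## §1 The two-centre superposition lemma -/

/-- [folklore] **TWO-CENTRE SUPERPOSITION**: weights decaying from BOTH `p` and `q` times stencils self-localised at their own index give a
kernel bi-localised at `(p, q)` (rate `δ/2`, constant `Cw·Ck·Zl D (δ/2)`).  The `p = q` case is `OneStepResolventKernel.biLoc_wsum`'s shape. -/
theorem biLoc_wsum_pair {D : ℕ} {F : Type*} {w : Site D → ℝ} {K : Site D → MKer D F} {Cw Ck δ : ℝ} {p q : Site D}
    (hw : ∀ u, |w u| ≤ Cw * Real.exp (-δ * (l1 (u - p) + l1 (u - q)))) (hK : ∀ u, BiLoc (K u) u u Ck δ) (hδ : 0 < δ)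
    (hCw : 0 ≤ Cw) (hCk : 0 ≤ Ck) :
    BiLoc (wsum w K) p q (Cw * Ck * Zl D (δ / 2)) (δ / 2) := by
  intro x z a b
  have hterm : ∀ u, |w u * K u x z a b| ≤
      Cw * Ck * Real.exp (-(δ / 2) * (l1 (x - p) + l1 (z - q))) * Real.exp (-(δ / 2) * l1 (x - u)) := by
    intro u
    rw [abs_mul]
    have h1 := hw u
    have h2 := hK u x z a b
    calc |w u| * |K u x z a b|
        ≤ (Cw * Real.exp (-δ * (l1 (u - p) + l1 (u - q)))) * (Ck * Real.exp (-δ * (l1 (x - u) + l1 (z - u)))) :=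
          mul_le_mul h1 h2 (abs_nonneg _) ((abs_nonneg _).trans h1)
      _ = Cw * Ck * Real.exp (-δ * (l1 (u - p) + l1 (u - q)) + -δ * (l1 (x - u) + l1 (z - u))) := by
          rw [Real.exp_add]; ring
      _ ≤ Cw * Ck * Real.exp (-(δ / 2) * (l1 (x - p) + l1 (z - q)) + -(δ / 2) * l1 (x - u)) := by
          refine mul_le_mul_of_nonneg_left (Real.exp_le_exp.2 ?_) (mul_nonneg hCw hCk)
          have tx : l1 (x - p) ≤ l1 (x - u) + l1 (u - p) := l1_sub_triangle x u p
          have tz : l1 (z - q) ≤ l1 (z - u) + l1 (u - q) := l1_sub_triangle z u q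
          have ha := l1_nonneg (u - p)
          have hb := l1_nonneg (u - q)
          have hc := l1_nonneg (x - u)
          have hd := l1_nonneg (z - u)
          have e1 := mul_le_mul_of_nonneg_left tx hδ.le
          have e2 := mul_le_mul_of_nonneg_left tz hδ.le
          nlinarith
      _ = Cw * Ck * Real.exp (-(δ / 2) * (l1 (x - p) + l1 (z - q))) * Real.exp (-(δ / 2) * l1 (x - u)) := by
          rw [Real.exp_add]; ring
  have hs := summable_exp_shift (half_pos hδ) x
  have hmaj := hs.mul_left (Cw * Ck * Real.exp (-(δ / 2) * (l1 (x - p) + l1 (z - q))))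
  have hb := tsum_of_norm_bounded hmaj.hasSum (fun u => by rw [Real.norm_eq_abs]; exact hterm u)
  rw [Real.norm_eq_abs] at hb
  show |∑' u, w u * K u x z a b| ≤ _
  refine hb.trans (le_of_eq ?_)
  rw [tsum_mul_left, tsum_exp_shift]
  ring

/-- [folklore] A scalar multiple of a bi-localised kernel (the shape of `SecondOrderResponse.biLoc_smul`, restated to keep the imports light). -/
theorem biLoc_smul' {D : ℕ} {F : Type*} {K : MKer D F} {p q : Site D} {C δ : ℝ} (c : ℝ) (h : BiLoc K p q C δ) :
    BiLoc (c • K) p q (|c| * C) δ := by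
  intro x z a b
  rw [Pi.smul_apply, Pi.smul_apply, Pi.smul_apply, Pi.smul_apply, smul_eq_mul, abs_mul, mul_assoc]
  exact mul_le_mul_of_nonneg_left (h x z a b) (abs_nonneg c)

/-! ## §2 The `ℋ⊗ℋ`-dressing of a bond-diagonal second-order table; block covariance of the reduced vertex -/

section Generic

variable {F : Type*}

/-- [our object] **THE DRESSED BOND-DIAGONAL TABLE** (blocking `n`, any fibre): for a fine table `T κ′ u` living on ONE fine bond (the
diagonal `[κ′ = λ′ ∧ u = u′]` of a two-bond family, as T6's `Wgh`), its `ℋ⊗ℋ`-dressing to the coarse bonds `(μ, y), (ν, y′)` is the single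
superposition `Σ_{κ′} Σ'_u wH κ′ μ (u − n•y) · wH κ′ ν (u − n•y′) · T κ′ u`.  A DEFINITION; asserts nothing. -/
def tableRedDiag (n : ℕ) [NeZero n] (T : Fin 4 → Site 4 → MKer 4 F) (μ : Fin 4) (y : Site 4) (ν : Fin 4) (y' : Site 4) :
    MKer 4 F :=
  fun x z a b => ∑ κ' : Fin 4,
    wsum (fun u => wH (N := n) (d := 3) κ' μ (u - (n : ℤ) • y) * wH (N := n) (d := 3) κ' ν (u - (n : ℤ) • y')) (T κ') x z a b

variable (n : ℕ) [NeZero n]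

/-- [folklore] **THE DRESSED DIAGONAL TABLE IS A SECOND-ORDER VERTEX FAMILY** (explicit): weights from `Decay510 (wH κ l) C δw` (both factors),
stencils `BiLoc (T κ′ u) u u Ck δ` (`Ck ≥ 0`) with `0 < δ ≤ δw` ⟹ `VertexFamily₂ (tableRedDiag n T) n (4·(C·C·Ck·Zl 4 (δ/2))) (δ/2)` (`biLoc_wsum_pair`). -/
theorem vertexFamily₂_tableRedDiag {T : Fin 4 → Site 4 → MKer 4 F} {Ck δ : ℝ} (hT : ∀ κ' u, BiLoc (T κ' u) u u Ck δ) (hCk : 0 ≤ Ck)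
    (hδ : 0 < δ) {C δw : ℝ} (hC : 0 ≤ C) (hδw : δ ≤ δw) (hwH : ∀ κ l : Fin 4, Decay510 (wH (N := n) (d := 3) κ l) C δw) :
    VertexFamily₂ (tableRedDiag n T) n ((4 : ℕ) * (C * C * Ck * Zl 4 (δ / 2))) (δ / 2) := by
  intro μ y ν y'
  have hw : ∀ κ' : Fin 4, ∀ u : Site 4,
      |wH (N := n) (d := 3) κ' μ (u - (n : ℤ) • y) * wH (N := n) (d := 3) κ' ν (u - (n : ℤ) • y')| ≤
        C * C * Real.exp (-δ * (l1 (u - (n : ℤ) • y) + l1 (u - (n : ℤ) • y'))) := by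
    intro κ' u
    rw [abs_mul]
    have h1 := bound_mono (hwH κ' μ (u - (n : ℤ) • y)) hC le_rfl hδw (l1_nonneg _)
    have h2 := bound_mono (hwH κ' ν (u - (n : ℤ) • y')) hC le_rfl hδw (l1_nonneg _)
    calc |wH (N := n) (d := 3) κ' μ (u - (n : ℤ) • y)| * |wH (N := n) (d := 3) κ' ν (u - (n : ℤ) • y')|
        ≤ (C * Real.exp (-δ * l1 (u - (n : ℤ) • y))) * (C * Real.exp (-δ * l1 (u - (n : ℤ) • y'))) :=
          mul_le_mul h1 h2 (abs_nonneg _) ((abs_nonneg _).trans h1)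
      _ = C * C * Real.exp (-δ * (l1 (u - (n : ℤ) • y) + l1 (u - (n : ℤ) • y'))) := by
          rw [mul_add, Real.exp_add]; ring
  have hterm : ∀ κ' : Fin 4, BiLoc (wsum (fun u => wH (N := n) (d := 3) κ' μ (u - (n : ℤ) • y) *
      wH (N := n) (d := 3) κ' ν (u - (n : ℤ) • y')) (T κ')) ((n : ℤ) • y) ((n : ℤ) • y') (C * C * Ck * Zl 4 (δ / 2)) (δ / 2) :=
    fun κ' => biLoc_wsum_pair (hw κ') (fun u => hT κ' u) hδ (mul_nonneg hC hC) hCk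
  have hsum := biLoc_finset_sum (Finset.univ : Finset (Fin 4)) (fun κ' _ => hterm κ')
  simp only [Finset.sum_const, Finset.card_univ, Fintype.card_fin, nsmul_eq_mul] at hsum
  exact hsum

/-- [folklore] **BLOCK COVARIANCE OF THE DRESSED DIAGONAL TABLE** (`BlockCovariant.covW`) for a block-covariant fine table
(`T κ′ (u + n•t) = shiftK (−n•t) (T κ′ u)`). -/
theorem tableRedDiag_translate {T : Fin 4 → Site 4 → MKer 4 F}
    (hT : ∀ (κ' : Fin 4) (u t : Site 4), T κ' (u + (n : ℤ) • t) = shiftK (-((n : ℤ) • t)) (T κ' u))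
    (μ : Fin 4) (y : Site 4) (ν : Fin 4) (y' t : Site 4) :
    tableRedDiag n T μ (y + t) ν (y' + t) = shiftK (-((n : ℤ) • t)) (tableRedDiag n T μ y ν y') := by
  funext x z a b
  simp only [tableRedDiag]
  have h : ∀ κ' : Fin 4,
      wsum (fun u => wH (N := n) (d := 3) κ' μ (u - (n : ℤ) • (y + t)) * wH (N := n) (d := 3) κ' ν (u - (n : ℤ) • (y' + t))) (T κ') =
      shiftK (-((n : ℤ) • t)) (wsum (fun u => wH (N := n) (d := 3) κ' μ (u - (n : ℤ) • y) *
        wH (N := n) (d := 3) κ' ν (u - (n : ℤ) • y')) (T κ')) := by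
    intro κ'
    have hw : (fun u => wH (N := n) (d := 3) κ' μ (u - (n : ℤ) • (y + t)) * wH (N := n) (d := 3) κ' ν (u - (n : ℤ) • (y' + t))) =
        fun u => (fun u' => wH (N := n) (d := 3) κ' μ (u' - (n : ℤ) • y) * wH (N := n) (d := 3) κ' ν (u' - (n : ℤ) • y'))
          (u - (n : ℤ) • t) := by
      funext u
      simp only [smul_add]
      congr 2 <;> abel
    rw [hw]
    exact wsum_shift (fun u' => wH (N := n) (d := 3) κ' μ (u' - (n : ℤ) • y) * wH (N := n) (d := 3) κ' ν (u' - (n : ℤ) • y'))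
      ((n : ℤ) • t) (fun u => hT κ' u t)
  simp only [h, shiftK, tableRedDiag]

/-- [folklore] **BLOCK-VECTOR TWIN of `ReducedKernelF.vertexRedF_translate`**: block covariance of the stencil family suffices for
`BlockCovariant.covV` of the reduced vertex (T6's `Sgh` is covariant under block vectors only). -/
theorem vertexRedF_translate_block {S : Fin 4 → Site 4 → MKer 4 F}
    (hS : ∀ (κ' : Fin 4) (u t : Site 4), S κ' (u + (n : ℤ) • t) = shiftK (-((n : ℤ) • t)) (S κ' u)) (μ : Fin 4) (y t : Site 4) :
    vertexRedF n S μ (y + t) = shiftK (-((n : ℤ) • t)) (vertexRedF n S μ y) := by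
  funext x z a b
  simp only [vertexRedF]
  have h : ∀ κ' : Fin 4, wsum (fun u => wH (N := n) (d := 3) κ' μ (u - (n : ℤ) • (y + t))) (S κ') =
      shiftK (-((n : ℤ) • t)) (wsum (fun u => wH (N := n) (d := 3) κ' μ (u - (n : ℤ) • y)) (S κ')) := by
    intro κ'
    have hw : (fun u => wH (N := n) (d := 3) κ' μ (u - (n : ℤ) • (y + t))) =
        fun u => (fun u' => wH (N := n) (d := 3) κ' μ (u' - (n : ℤ) • y)) (u - (n : ℤ) • t) := by
      funext u
      simp only [smul_add]
      congr 1
      abel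
    rw [hw]
    exact wsum_shift (fun u' => wH (N := n) (d := 3) κ' μ (u' - (n : ℤ) • y)) ((n : ℤ) • t) (fun u => hS κ' u t)
  simp only [h, shiftK, vertexRedF]

end Generic

/-! ## §3 The ghost fine kernel -/

section Ghost

/-- [our object] **T7-gh — THE GHOST FINE ONE-SHOT KERNEL** at block size `n`, averaging weight `a`, real stencil/table weights `cK, cQ, cW`:
`Pgh n a cK cQ cW := TOfGh n a (Sgh n cK cQ) (tableRedDiag n (κ′ u ↦ cW • ghCnt κ′ u))` — the ghost leg (T2) with the dressed ghost stencils
(T6) in the reduced Hessian shape (T8-gh).  The loop weight of leaf R1 is NOT applied.  A DEFINITION; asserts nothing. -/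
def Pgh (n : ℕ) [NeZero n] (a cK cQ cW : ℝ) : Fin 4 → Fin 4 → Site 4 → ℝ :=
  TOfGh n a (Sgh n cK cQ) (tableRedDiag n (fun κ' u => cW • ghCnt κ' u))

variable (n : ℕ) [NeZero n] (a cK cQ cW : ℝ)

/-- [our object] Unfolding `Pgh`. -/
theorem Pgh_eq : Pgh n a cK cQ cW = hessKer (Ggh n a) (vertexRedF n (Sgh n cK cQ)) (tableRedDiag n (fun κ' u => cW • ghCnt κ' u)) := rfl

/-- [folklore] shifting commutes with scalars: `shiftK v (c • K) = c • shiftK v K`. -/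
theorem shiftK_smul {D : ℕ} {F : Type*} (v : Site D) (c : ℝ) (K : MKer D F) : shiftK v (c • K) = c • shiftK v K := rfl

omit [NeZero n] in
/-- [folklore] The scaled contact table is block-covariant (indeed covariant under every fine translation, `ghCnt_translate`). -/
theorem ghTable_translate (κ' : Fin 4) (u t : Site 4) :
    (fun κ' u => cW • ghCnt κ' u) κ' (u + (n : ℤ) • t) = shiftK (-((n : ℤ) • t)) ((fun κ' u => cW • ghCnt κ' u) κ' u) := by
  simp only [ghCnt_translate κ' u ((n : ℤ) • t), shiftK_smul]

/-- [folklore] **BLOCK COVARIANCE OF THE GHOST DATA** (`a > 0`): `BlockCovariant (Ggh n a) (vertexRedF n (Sgh n cK cQ)) (tableRedDiag n (cW • ghCnt)) n`. -/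
theorem blockCovariant_Pgh (ha : 0 < a) :
    BlockCovariant (Ggh n a) (vertexRedF n (Sgh n cK cQ)) (tableRedDiag n (fun κ' u => cW • ghCnt κ' u)) n :=
  ⟨fun t => shiftK_Ggh_neg n a ha t,
   fun μ y t => vertexRedF_translate_block n (fun κ' u t => Sgh_translate κ' u n cK cQ t) μ y t,
   fun μ y ν y' t => tableRedDiag_translate n (fun κ' u t => ghTable_translate n cW κ' u t) μ y ν y' t⟩

/-- [folklore] **BASE POINT**: `hess (Ggh n a) (vertexRedF n (Sgh …)) (tableRedDiag …) μ y ν y′ = Pgh n a cK cQ cW μ ν (y′ − y)`. -/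
theorem hess_eq_Pgh (ha : 0 < a) (μ : Fin 4) (y : Site 4) (ν : Fin 4) (y' : Site 4) :
    hess (Ggh n a) (vertexRedF n (Sgh n cK cQ)) (tableRedDiag n (fun κ' u => cW • ghCnt κ' u)) μ y ν y' =
      Pgh n a cK cQ cW μ ν (y' - y) :=
  hess_eq_hessKer (blockCovariant_Pgh n a cK cQ cW ha) μ y ν y'

/-- [folklore] **THE DRESSED GHOST VERTEX IS A VERTEX FAMILY**, with SOME constant and a positive rate (T6's `biLoc_Sgh` at rate `1/n` +
`KernelSpecInstance.decay_wH`, rates matched by monotonicity). -/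
theorem exists_vertexFamily_Sgh : ∃ Cv δv : ℝ, 0 < δv ∧ VertexFamily (vertexRedF n (Sgh n cK cQ)) n Cv δv := by
  have hn : (0 : ℝ) < n := by exact_mod_cast Nat.pos_of_ne_zero (NeZero.ne n)
  obtain ⟨δw, Cw, hδw, hwH⟩ := decay_wH (N := n) (d := 3)
  have hCw : 0 ≤ Cw := by
    have h0 := hwH 0 0 0
    simp only [l1, Pi.zero_apply, Int.cast_zero, abs_zero, Finset.sum_const_zero, mul_zero, Real.exp_zero, mul_one] at h0
    exact (abs_nonneg _).trans h0
  -- stencil rate: `min δw 1 / n ≤ δw`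
  set δ₀ : ℝ := min δw 1 with hδ₀
  have hδ₀pos : 0 < δ₀ := lt_min hδw one_pos
  have hS := fun κ' u => biLoc_Sgh κ' u n cK cQ hδ₀pos.le
  have hrate : δ₀ / n ≤ δw := by
    have h1 : δ₀ / n ≤ δ₀ := div_le_self hδ₀pos.le (by exact_mod_cast NeZero.one_le)
    exact h1.trans (min_le_left _ _)
  exact ⟨_, _, half_pos (div_pos hδ₀pos hn), vertexFamily_vertexRedF n hS (div_pos hδ₀pos hn) hCw hrate hwH⟩

/-- [folklore] **THE DRESSED GHOST CONTACT TABLE IS A SECOND-ORDER VERTEX FAMILY**, with SOME constant and a positive rate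
(`biLoc_ghCnt` + `biLoc_smul` + `decay_wH`, via `vertexFamily₂_tableRedDiag`). -/
theorem exists_vertexFamily₂_ghTable :
    ∃ C2 δ2 : ℝ, 0 < δ2 ∧ VertexFamily₂ (tableRedDiag n (fun κ' u => cW • ghCnt κ' u)) n C2 δ2 := by
  obtain ⟨δw, Cw, hδw, hwH⟩ := decay_wH (N := n) (d := 3)
  have hCw : 0 ≤ Cw := by
    have h0 := hwH 0 0 0
    simp only [l1, Pi.zero_apply, Int.cast_zero, abs_zero, Finset.sum_const_zero, mul_zero, Real.exp_zero, mul_one] at h0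
    exact (abs_nonneg _).trans h0
  have hT : ∀ κ' u, BiLoc ((fun κ' u => cW • ghCnt κ' u) κ' u) u u (|cW| * Real.exp (2 * δw)) δw :=
    fun κ' u => biLoc_smul' cW (biLoc_ghCnt κ' u δw)
  exact ⟨_, _, half_pos hδw, vertexFamily₂_tableRedDiag n hT (by positivity) hδw hCw le_rfl hwH⟩

/-- [folklore] **T7-gh: THE GHOST FINE KERNEL IS WELL-TYPED** — `AbsMoment₂ (Pgh n a cK cQ cW μ ν)` for every channel, every block size
`n ≥ 1`, every `a > 0` and all real weights; NO other hypothesis (ghost leg `decays_Ggh`, T6 sockets, `decay_wH`). -/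
theorem absMoment₂_Pgh (ha : 0 < a) (μ ν : Fin 4) : AbsMoment₂ (Pgh n a cK cQ cW μ ν) := by
  obtain ⟨Cv, δv, hδv, hV⟩ := exists_vertexFamily_Sgh n cK cQ
  obtain ⟨C2, δ2, hδ2, hW⟩ := exists_vertexFamily₂_ghTable n cW
  exact absMoment₂_TOfGh n a ha hV hδv hW hδ2 μ ν

/-- [folklore] **(5.10)-SHAPE DECAY OF EVERY CHANNEL OF THE GHOST FINE KERNEL**, with SOME constant and positive rate (per `n`):
`∃ C δ, 0 < δ ∧ ∀ μ ν, Decay510 (Pgh n a cK cQ cW μ ν) C δ` (`ExpKernelCalculus.hdec_hessKer`, rates matched by monotonicity). -/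
theorem exists_decay510_Pgh (ha : 0 < a) : ∃ C δ : ℝ, 0 < δ ∧ ∀ μ ν : Fin 4, Decay510 (Pgh n a cK cQ cW μ ν) C δ := by
  have hn1 : 1 ≤ n := NeZero.one_le
  have hn : (0 : ℝ) < n := by exact_mod_cast hn1
  obtain ⟨Cv, δv, hδv, hV⟩ := exists_vertexFamily_Sgh n cK cQ
  obtain ⟨C2, δ2, hδ2, hW⟩ := exists_vertexFamily₂_ghTable n cW
  have hA := decays_Ggh n a ha
  have hrate : 0 < deltaU 4 a / (4 * (n : ℝ)) := by have := deltaU_pos 4 ha; positivity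
  set δ' : ℝ := min (deltaU 4 a / (4 * (n : ℝ))) (min δv δ2) with hδ'
  have hδ'pos : 0 < δ' := lt_min hrate (lt_min hδv hδ2)
  have hCv : 0 ≤ Cv := (hV 0 0).nonneg ()
  have hC2 : 0 ≤ C2 := (hW 0 0 0 0).nonneg ()
  have hA' : Decays (Ggh n a) (2 / min 2 a) δ' := decays_mono hA (const_nonneg a ha) le_rfl (min_le_left _ _)
  have hV' : VertexFamily (vertexRedF n (Sgh n cK cQ)) n Cv δ' := fun μ y =>
    biLoc_mono (hV μ y) hCv ((min_le_right _ _).trans (min_le_left _ _))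
  have hW' : VertexFamily₂ (tableRedDiag n (fun κ' u => cW • ghCnt κ' u)) n C2 δ' := fun μ y ν y' =>
    biLoc_mono (hW μ y ν y') hC2 ((min_le_right _ _).trans (min_le_right _ _))
  obtain ⟨C', δ'', hδ'', h⟩ := hdec_hessKer hA' hV' hW' hδ'pos hn1
  exact ⟨C', δ'', hδ'', fun μ ν => h μ ν⟩

end Ghost

end Summit.QuantumFields.BalabanUV.Beta.D1BFx.GhostKernel

end
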